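import Summits.KontsevichZagierPeriods.KontsevichZagierPeriods.Theorems.HurwitzMicroSectorsNormalFormPrincipleM4SimplexFacts
import Summits.KontsevichZagierPeriods.KontsevichZagierPeriods.Theorems.FurushoPentagonHoffmanRelationInKZCubicalTransportAux

/-!
# `NormalFormPrinciple` (stmt-KontsevichZagierPeriods-3869), line `SketchIdeator1` —
# leaf `stub_boxRigidity`, layer `M4` toolkit: the two prism charts of the unit box `□⁴`

Pure proof file (registered sub-goal `m4_box_sub_prisms4` of stmt-KontsevichZagierPeriods-3869,
line `SketchIdeator1`, lead seat c9; layer `M4` toolkit = the dimension-four campaign of the leaf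
`stub_boxRigidity`; `--supports` the crux). The shuffle products `1 ⊗ 3` and `2 ⊗ 2` of the
dimension-four campaign live on the prisms

  `P₁₃ = (0,1) × Δ₃ = {0 < t₀ < 1, 0 < t₃ < t₂ < t₁ < 1}`,
  `P₂₂ = Δ₂ × Δ₂ = {0 < t₁ < t₀ < 1, 0 < t₃ < t₂ < 1}`,

and are compared with boxes through ONE change-of-variables move (rule (2) of the
Kontsevich–Zagier calculus, `KZ.changeOfVariablesRel`) along the two *prism charts* of the open
unit box `□⁴ = (0,1)⁴`, both monomial charts with lower-triangular Jacobian: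

  `C₁₃(x) = (x₀, x₁, x₁x₂, x₁x₂x₃)`   (rows `{0}, {1}, {1,2}, {1,2,3}`, Jacobian `x₁²x₂`),
  `C₂₂(x) = (x₀, x₀x₁, x₂, x₂x₃)`     (rows `{0}, {0,1}, {2}, {2,3}`, Jacobian `x₀x₂`).

For each chart and a GENERIC target integrand `g` two things are proved: the *move* — every
representation `N` on `□⁴` whose integrand is the pulled-back integrand `g (C x) · Jac C (x)` is
KZ-equivalent to every representation `T = [P, ≡ g]`; and the *existence* of such an `N` given
`T` (absolute integrability transported along the chart by
`MeasureTheory.integrableOn_image_iff_integrableOn_abs_det_fderiv_smul`). Both are instances of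
the generic monomial-chart transport
`FurushoPentagon.HoffmanRelationInKZ.monomialChart_transport`; what is proved here by hand is the
calculus of the two particular charts: the evaluation of the monomial rows and of the triangular
Jacobian, injectivity on the box, and the image EXACTLY the typed prism (inverses
`(t₀, t₁, t₂/t₁, t₃/t₂)` and `(t₀, t₁/t₀, t₂, t₃/t₂)`).

References: M. Kontsevich, D. Zagier, *Periods* (2001), §1.1–1.2 (rule (2)). No definitions are
introduced.
-/

noncomputable section

open MeasureTheory Set
open Literature.NumberTheory.Transcendental Literature.NumberTheory.Transcendental.KZ
open Literature.ModelTheory.ExponentialFields (IsSemialgebraic)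
open Summit.KontsevichZagierPeriods.FurushoPentagon.HoffmanRelationInKZ (monomialChart_transport)

namespace Summit.KontsevichZagierPeriods.HurwitzMicroSectors.NormalFormPrinciple.PiBox.M3

/-! ## The chart `C₁₃` of `P₁₃ = (0,1) × Δ₃` -/

/-- The rows of `C₁₃` are supported on `j ≤ i` and contain the diagonal. [folklore] -/
private theorem m4p_rows13 :
    (∀ i, ∀ j ∈ (![{0}, {1}, {1, 2}, {1, 2, 3}] : Fin 4 → Finset (Fin 4)) i, j ≤ i) ∧
      (∀ i, i ∈ (![{0}, {1}, {1, 2}, {1, 2, 3}] : Fin 4 → Finset (Fin 4)) i) := by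
  decide

/-- `C₁₃` in monomial normal form: `(∏_{j ∈ S₁₃ i} y_j)_i = (y₀, y₁, y₁y₂, y₁y₂y₃)`. [folklore] -/
private theorem m4p_chart13 (y : Fin 4 → ℝ) (i : Fin 4) :
    (![y 0, y 1, y 1 * y 2, y 1 * y 2 * y 3] : Fin 4 → ℝ) i =
      ∏ j ∈ (![{0}, {1}, {1, 2}, {1, 2, 3}] : Fin 4 → Finset (Fin 4)) i, y j := by
  match i with
  | 0 => simp
  | 1 => simp
  | 2 =>
    simp only [Matrix.cons_val_two, Matrix.tail_cons, Matrix.head_cons]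
    rw [Finset.prod_pair (by decide)]
  | 3 =>
    simp only [Matrix.cons_val_three, Matrix.tail_cons, Matrix.head_cons]
    rw [Finset.prod_insert (by decide), Finset.prod_pair (by decide), mul_assoc]

/-- The Jacobian of `C₁₃`: `∏ᵢ ∏_{k ∈ S₁₃ i, k ≠ i} y_k = y₁² y₂`. [folklore] -/
private theorem m4p_jac13 (y : Fin 4 → ℝ) :
    ∏ i, ∏ k ∈ ((![{0}, {1}, {1, 2}, {1, 2, 3}] : Fin 4 → Finset (Fin 4)) i).erase i, y k =
      y 1 ^ 2 * y 2 := by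
  rw [Fin.prod_univ_four]
  have h0 : ((![{0}, {1}, {1, 2}, {1, 2, 3}] : Fin 4 → Finset (Fin 4)) 0).erase 0 = ∅ := by decide
  have h1 : ((![{0}, {1}, {1, 2}, {1, 2, 3}] : Fin 4 → Finset (Fin 4)) 1).erase 1 = ∅ := by decide
  have h2 : ((![{0}, {1}, {1, 2}, {1, 2, 3}] : Fin 4 → Finset (Fin 4)) 2).erase 2 = {1} := by decide
  have h3 : ((![{0}, {1}, {1, 2}, {1, 2, 3}] : Fin 4 → Finset (Fin 4)) 3).erase 3 = {1, 2} := by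
    decide
  rw [h0, h1, h2, h3, Finset.prod_pair (by decide)]
  simp only [Finset.prod_empty, Finset.prod_singleton]
  ring

/-- `C₁₃` is injective on the open box (`x₂ = t₂/t₁`, `x₃ = t₃/t₂`). [folklore] -/
private theorem m4p_injOn13 :
    InjOn (fun y : Fin 4 → ℝ => (![y 0, y 1, y 1 * y 2, y 1 * y 2 * y 3] : Fin 4 → ℝ))
      {x : Fin 4 → ℝ | ∀ i, x i ∈ Set.Ioo (0:ℝ) 1} := by
  intro x hx y _ hxy
  have e0 : x 0 = y 0 := by simpa using congr_fun hxy 0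
  have e1 : x 1 = y 1 := by simpa using congr_fun hxy 1
  have e2 : x 1 * x 2 = y 1 * y 2 := by simpa using congr_fun hxy 2
  have e3 : x 1 * x 2 * x 3 = y 1 * y 2 * y 3 := by simpa using congr_fun hxy 3
  have f2 : x 2 = y 2 := by
    rw [← e1] at e2
    exact mul_left_cancel₀ (hx 1).1.ne' e2
  have f3 : x 3 = y 3 := by
    rw [← e2] at e3
    exact mul_left_cancel₀ (mul_pos (hx 1).1 (hx 2).1).ne' e3
  funext i
  match i with
  | 0 => exact e0
  | 1 => exact e1
  | 2 => exact f2
  | 3 => exact f3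

/-- `C₁₃` maps the open box ONTO the prism `P₁₃` (inverse `(t₀, t₁, t₂/t₁, t₃/t₂)`). [folklore] -/
private theorem m4p_image13 :
    (fun y : Fin 4 → ℝ => (![y 0, y 1, y 1 * y 2, y 1 * y 2 * y 3] : Fin 4 → ℝ)) ''
        {x : Fin 4 → ℝ | ∀ i, x i ∈ Set.Ioo (0:ℝ) 1} =
      {t | 0 < t 0 ∧ t 0 < 1 ∧ 0 < t 3 ∧ t 3 < t 2 ∧ t 2 < t 1 ∧ t 1 < 1} := by
  ext t
  constructor
  · rintro ⟨x, hx, rfl⟩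
    have h0 := hx 0
    have h1 := hx 1
    have h2 := hx 2
    have h3 := hx 3
    simp only [mem_setOf_eq, Matrix.cons_val_zero, Matrix.cons_val_one, Matrix.cons_val_two,
      Matrix.cons_val_three, Matrix.tail_cons, Matrix.head_cons]
    exact ⟨h0.1, h0.2, mul_pos (mul_pos h1.1 h2.1) h3.1,
      mul_lt_of_lt_one_right (mul_pos h1.1 h2.1) h3.2, mul_lt_of_lt_one_right h1.1 h2.2, h1.2⟩
  · rintro ⟨h0, h01, h3, h32, h21, h1⟩
    have ht2 : 0 < t 2 := h3.trans h32
    have ht1 : 0 < t 1 := ht2.trans h21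
    refine ⟨![t 0, t 1, t 2 / t 1, t 3 / t 2], ?_, ?_⟩
    · intro i
      match i with
      | 0 => exact ⟨h0, h01⟩
      | 1 => exact ⟨ht1, h1⟩
      | 2 => exact ⟨div_pos ht2 ht1, (div_lt_one ht1).2 h21⟩
      | 3 => exact ⟨div_pos h3 ht2, (div_lt_one ht2).2 h32⟩
    · funext i
      match i with
      | 0 => simp
      | 1 => simp
      | 2 =>
        simp only [Matrix.cons_val_zero, Matrix.cons_val_one, Matrix.cons_val_two,
          Matrix.tail_cons, Matrix.head_cons]
        exact mul_div_cancel₀ _ ht1.ne'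
      | 3 =>
        simp only [Matrix.cons_val_zero, Matrix.cons_val_one, Matrix.cons_val_two,
          Matrix.cons_val_three, Matrix.tail_cons, Matrix.head_cons]
        rw [mul_div_cancel₀ _ ht1.ne', mul_div_cancel₀ _ ht2.ne']

/-- The monomial-chart transport along `C₁₃` for a generic target integrand `g`: existence of the
pulled-back representation on the box and the rule-(2) equivalence.
[cite: KontsevichZagier2001, §1.2 rule (2)] -/
private theorem m4p_transport13 (g : (Fin 4 → ℝ) → ℝ) :
    (∀ r' : IntegralRep 4, r'.domain =
        (fun y : Fin 4 → ℝ => (![y 0, y 1, y 1 * y 2, y 1 * y 2 * y 3] : Fin 4 → ℝ)) ''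
          {x : Fin 4 → ℝ | ∀ i, x i ∈ Set.Ioo (0:ℝ) 1} →
      EqOn r'.integrand g r'.domain →
      ∃ r : IntegralRep 4, r.domain = {x : Fin 4 → ℝ | ∀ i, x i ∈ Set.Ioo (0:ℝ) 1} ∧
        r.integrand = fun x => g ![x 0, x 1, x 1 * x 2, x 1 * x 2 * x 3] * (x 1 ^ 2 * x 2)) ∧
    (∀ r r' : IntegralRep 4, r.domain = {x : Fin 4 → ℝ | ∀ i, x i ∈ Set.Ioo (0:ℝ) 1} →
      EqOn r.integrand (fun x => g ![x 0, x 1, x 1 * x 2, x 1 * x 2 * x 3] * (x 1 ^ 2 * x 2))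
        {x : Fin 4 → ℝ | ∀ i, x i ∈ Set.Ioo (0:ℝ) 1} →
      r'.domain = (fun y : Fin 4 → ℝ => (![y 0, y 1, y 1 * y 2, y 1 * y 2 * y 3] : Fin 4 → ℝ)) ''
          {x : Fin 4 → ℝ | ∀ i, x i ∈ Set.Ioo (0:ℝ) 1} →
      EqOn r'.integrand g r'.domain → KZ.Equivalent r r') := by
  obtain ⟨hS, hS'⟩ := m4p_rows13
  refine monomialChart_transport (![{0}, {1}, {1, 2}, {1, 2, 3}] : Fin 4 → Finset (Fin 4)) hS hS'
    (isSemialgebraic_box 4)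
    (fun y : Fin 4 → ℝ => (![y 0, y 1, y 1 * y 2, y 1 * y 2 * y 3] : Fin 4 → ℝ)) m4p_chart13
    m4p_injOn13 (fun x => g ![x 0, x 1, x 1 * x 2, x 1 * x 2 * x 3] * (x 1 ^ 2 * x 2)) g
    fun y hy => ?_
  have hJ : 0 < y 1 ^ 2 * y 2 := mul_pos (pow_pos (hy 1).1 2) (hy 2).1
  simp only [m4p_jac13, abs_of_pos hJ]

/-! ## The chart `C₂₂` of `P₂₂ = Δ₂ × Δ₂` -/

/-- The rows of `C₂₂` are supported on `j ≤ i` and contain the diagonal. [folklore] -/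
private theorem m4p_rows22 :
    (∀ i, ∀ j ∈ (![{0}, {0, 1}, {2}, {2, 3}] : Fin 4 → Finset (Fin 4)) i, j ≤ i) ∧
      (∀ i, i ∈ (![{0}, {0, 1}, {2}, {2, 3}] : Fin 4 → Finset (Fin 4)) i) := by
  decide

/-- `C₂₂` in monomial normal form: `(∏_{j ∈ S₂₂ i} y_j)_i = (y₀, y₀y₁, y₂, y₂y₃)`. [folklore] -/
private theorem m4p_chart22 (y : Fin 4 → ℝ) (i : Fin 4) :
    (![y 0, y 0 * y 1, y 2, y 2 * y 3] : Fin 4 → ℝ) i =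
      ∏ j ∈ (![{0}, {0, 1}, {2}, {2, 3}] : Fin 4 → Finset (Fin 4)) i, y j := by
  match i with
  | 0 => simp
  | 1 =>
    simp only [Matrix.cons_val_one, Matrix.cons_val_zero]
    rw [Finset.prod_pair (by decide)]
  | 2 => simp
  | 3 =>
    simp only [Matrix.cons_val_three, Matrix.tail_cons, Matrix.head_cons]
    rw [Finset.prod_pair (by decide)]

/-- The Jacobian of `C₂₂`: `∏ᵢ ∏_{k ∈ S₂₂ i, k ≠ i} y_k = y₀ y₂`. [folklore] -/
private theorem m4p_jac22 (y : Fin 4 → ℝ) :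
    ∏ i, ∏ k ∈ ((![{0}, {0, 1}, {2}, {2, 3}] : Fin 4 → Finset (Fin 4)) i).erase i, y k =
      y 0 * y 2 := by
  rw [Fin.prod_univ_four]
  have h0 : ((![{0}, {0, 1}, {2}, {2, 3}] : Fin 4 → Finset (Fin 4)) 0).erase 0 = ∅ := by decide
  have h1 : ((![{0}, {0, 1}, {2}, {2, 3}] : Fin 4 → Finset (Fin 4)) 1).erase 1 = {0} := by decide
  have h2 : ((![{0}, {0, 1}, {2}, {2, 3}] : Fin 4 → Finset (Fin 4)) 2).erase 2 = ∅ := by decide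
  have h3 : ((![{0}, {0, 1}, {2}, {2, 3}] : Fin 4 → Finset (Fin 4)) 3).erase 3 = {2} := by decide
  rw [h0, h1, h2, h3]
  simp only [Finset.prod_empty, Finset.prod_singleton]
  ring

/-- `C₂₂` is injective on the open box (`x₁ = t₁/t₀`, `x₃ = t₃/t₂`). [folklore] -/
private theorem m4p_injOn22 :
    InjOn (fun y : Fin 4 → ℝ => (![y 0, y 0 * y 1, y 2, y 2 * y 3] : Fin 4 → ℝ))
      {x : Fin 4 → ℝ | ∀ i, x i ∈ Set.Ioo (0:ℝ) 1} := by
  intro x hx y _ hxy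
  have e0 : x 0 = y 0 := by simpa using congr_fun hxy 0
  have e1 : x 0 * x 1 = y 0 * y 1 := by simpa using congr_fun hxy 1
  have e2 : x 2 = y 2 := by simpa using congr_fun hxy 2
  have e3 : x 2 * x 3 = y 2 * y 3 := by simpa using congr_fun hxy 3
  have f1 : x 1 = y 1 := by
    rw [← e0] at e1
    exact mul_left_cancel₀ (hx 0).1.ne' e1
  have f3 : x 3 = y 3 := by
    rw [← e2] at e3
    exact mul_left_cancel₀ (hx 2).1.ne' e3
  funext i
  match i with
  | 0 => exact e0
  | 1 => exact f1
  | 2 => exact e2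
  | 3 => exact f3

/-- `C₂₂` maps the open box ONTO the prism `P₂₂` (inverse `(t₀, t₁/t₀, t₂, t₃/t₂)`). [folklore] -/
private theorem m4p_image22 :
    (fun y : Fin 4 → ℝ => (![y 0, y 0 * y 1, y 2, y 2 * y 3] : Fin 4 → ℝ)) ''
        {x : Fin 4 → ℝ | ∀ i, x i ∈ Set.Ioo (0:ℝ) 1} =
      {t | 0 < t 1 ∧ t 1 < t 0 ∧ t 0 < 1 ∧ 0 < t 3 ∧ t 3 < t 2 ∧ t 2 < 1} := by
  ext t
  constructor
  · rintro ⟨x, hx, rfl⟩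
    have h0 := hx 0
    have h1 := hx 1
    have h2 := hx 2
    have h3 := hx 3
    simp only [mem_setOf_eq, Matrix.cons_val_zero, Matrix.cons_val_one, Matrix.cons_val_two,
      Matrix.cons_val_three, Matrix.tail_cons, Matrix.head_cons]
    exact ⟨mul_pos h0.1 h1.1, mul_lt_of_lt_one_right h0.1 h1.2, h0.2, mul_pos h2.1 h3.1,
      mul_lt_of_lt_one_right h2.1 h3.2, h2.2⟩
  · rintro ⟨h1, h10, h0, h3, h32, h2⟩
    have ht0 : 0 < t 0 := h1.trans h10
    have ht2 : 0 < t 2 := h3.trans h32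
    refine ⟨![t 0, t 1 / t 0, t 2, t 3 / t 2], ?_, ?_⟩
    · intro i
      match i with
      | 0 => exact ⟨ht0, h0⟩
      | 1 => exact ⟨div_pos h1 ht0, (div_lt_one ht0).2 h10⟩
      | 2 => exact ⟨ht2, h2⟩
      | 3 => exact ⟨div_pos h3 ht2, (div_lt_one ht2).2 h32⟩
    · funext i
      match i with
      | 0 => simp
      | 1 =>
        simp only [Matrix.cons_val_zero, Matrix.cons_val_one]
        exact mul_div_cancel₀ _ ht0.ne'
      | 2 => simp only [Matrix.cons_val_two, Matrix.tail_cons, Matrix.head_cons]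
      | 3 =>
        simp only [Matrix.cons_val_two, Matrix.cons_val_three, Matrix.tail_cons, Matrix.head_cons]
        exact mul_div_cancel₀ _ ht2.ne'

/-- The monomial-chart transport along `C₂₂` for a generic target integrand `g`: existence of the
pulled-back representation on the box and the rule-(2) equivalence.
[cite: KontsevichZagier2001, §1.2 rule (2)] -/
private theorem m4p_transport22 (g : (Fin 4 → ℝ) → ℝ) :
    (∀ r' : IntegralRep 4, r'.domain =
        (fun y : Fin 4 → ℝ => (![y 0, y 0 * y 1, y 2, y 2 * y 3] : Fin 4 → ℝ)) ''
          {x : Fin 4 → ℝ | ∀ i, x i ∈ Set.Ioo (0:ℝ) 1} →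
      EqOn r'.integrand g r'.domain →
      ∃ r : IntegralRep 4, r.domain = {x : Fin 4 → ℝ | ∀ i, x i ∈ Set.Ioo (0:ℝ) 1} ∧
        r.integrand = fun x => g ![x 0, x 0 * x 1, x 2, x 2 * x 3] * (x 0 * x 2)) ∧
    (∀ r r' : IntegralRep 4, r.domain = {x : Fin 4 → ℝ | ∀ i, x i ∈ Set.Ioo (0:ℝ) 1} →
      EqOn r.integrand (fun x => g ![x 0, x 0 * x 1, x 2, x 2 * x 3] * (x 0 * x 2))
        {x : Fin 4 → ℝ | ∀ i, x i ∈ Set.Ioo (0:ℝ) 1} →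
      r'.domain = (fun y : Fin 4 → ℝ => (![y 0, y 0 * y 1, y 2, y 2 * y 3] : Fin 4 → ℝ)) ''
          {x : Fin 4 → ℝ | ∀ i, x i ∈ Set.Ioo (0:ℝ) 1} →
      EqOn r'.integrand g r'.domain → KZ.Equivalent r r') := by
  obtain ⟨hS, hS'⟩ := m4p_rows22
  refine monomialChart_transport (![{0}, {0, 1}, {2}, {2, 3}] : Fin 4 → Finset (Fin 4)) hS hS'
    (isSemialgebraic_box 4)
    (fun y : Fin 4 → ℝ => (![y 0, y 0 * y 1, y 2, y 2 * y 3] : Fin 4 → ℝ)) m4p_chart22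
    m4p_injOn22 (fun x => g ![x 0, x 0 * x 1, x 2, x 2 * x 3] * (x 0 * x 2)) g
    fun y hy => ?_
  have hJ : 0 < y 0 * y 2 := mul_pos (hy 0).1 (hy 2).1
  simp only [m4p_jac22, abs_of_pos hJ]

/-! ## The registered sub-goal -/

/-- **Stub `m4_box_sub_prisms4` (registered sub-goal of stmt-KontsevichZagierPeriods-3869, line
`SketchIdeator1`, layer `M4` toolkit).** The two prism charts of the open unit box `□⁴`:
(P13) along `C₁₃(x) = (x₀, x₁, x₁x₂, x₁x₂x₃)` (Jacobian `x₁²x₂`, image the prism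
`P₁₃ = {0 < t₀ < 1, 0 < t₃ < t₂ < t₁ < 1}`), every representation `N` on `□⁴` with integrand
`g (C₁₃ x) · x₁²x₂` is KZ-equivalent — by ONE change-of-variables move `KZ.changeOfVariablesRel` —
to every representation `T` on `P₁₃` with integrand `g` there, and such an `N` exists as soon as
`T` does (absolute integrability transported along the chart); (P22) the same along
`C₂₂(x) = (x₀, x₀x₁, x₂, x₂x₃)` (Jacobian `x₀x₂`, image `P₂₂ = {0 < t₁ < t₀ < 1, 0 < t₃ < t₂ < 1}`).
Both are the generic monomial-chart transport `monomialChart_transport` fed with the calculus of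
the two charts (`m4p_chart13/22`, `m4p_jac13/22`, `m4p_injOn13/22`, `m4p_image13/22`).
[cite: KontsevichZagier2001, §1.2 rule (2)] -/
theorem m4_box_sub_prisms4 :
    (∀ (g : (Fin 4 → ℝ) → ℝ) (N T : IntegralRep 4),
      N.domain = {x | ∀ i, x i ∈ Set.Ioo (0:ℝ) 1} →
      T.domain = {t | 0 < t 0 ∧ t 0 < 1 ∧ 0 < t 3 ∧ t 3 < t 2 ∧ t 2 < t 1 ∧ t 1 < 1} →
      EqOn T.integrand g T.domain →
      EqOn N.integrand (fun x => g ![x 0, x 1, x 1 * x 2, x 1 * x 2 * x 3] * (x 1 ^ 2 * x 2))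
        N.domain →
      of N - of T ∈ relations) ∧
    (∀ (g : (Fin 4 → ℝ) → ℝ) (T : IntegralRep 4),
      T.domain = {t | 0 < t 0 ∧ t 0 < 1 ∧ 0 < t 3 ∧ t 3 < t 2 ∧ t 2 < t 1 ∧ t 1 < 1} →
      EqOn T.integrand g T.domain →
      ∃ N : IntegralRep 4, N.domain = {x | ∀ i, x i ∈ Set.Ioo (0:ℝ) 1} ∧
        N.integrand = fun x => g ![x 0, x 1, x 1 * x 2, x 1 * x 2 * x 3] * (x 1 ^ 2 * x 2)) ∧
    (∀ (g : (Fin 4 → ℝ) → ℝ) (N T : IntegralRep 4),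
      N.domain = {x | ∀ i, x i ∈ Set.Ioo (0:ℝ) 1} →
      T.domain = {t | 0 < t 1 ∧ t 1 < t 0 ∧ t 0 < 1 ∧ 0 < t 3 ∧ t 3 < t 2 ∧ t 2 < 1} →
      EqOn T.integrand g T.domain →
      EqOn N.integrand (fun x => g ![x 0, x 0 * x 1, x 2, x 2 * x 3] * (x 0 * x 2)) N.domain →
      of N - of T ∈ relations) ∧
    (∀ (g : (Fin 4 → ℝ) → ℝ) (T : IntegralRep 4),
      T.domain = {t | 0 < t 1 ∧ t 1 < t 0 ∧ t 0 < 1 ∧ 0 < t 3 ∧ t 3 < t 2 ∧ t 2 < 1} →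
      EqOn T.integrand g T.domain →
      ∃ N : IntegralRep 4, N.domain = {x | ∀ i, x i ∈ Set.Ioo (0:ℝ) 1} ∧
        N.integrand = fun x => g ![x 0, x 0 * x 1, x 2, x 2 * x 3] * (x 0 * x 2)) := by
  refine ⟨fun g N T hNd hTd hTg hNi => ?_, fun g T hTd hTg => ?_,
    fun g N T hNd hTd hTg hNi => ?_, fun g T hTd hTg => ?_⟩
  · -- (P13) the move: conjunct 2 of the transport along `C₁₃`
    have hTd' : T.domain =
        (fun y : Fin 4 → ℝ => (![y 0, y 1, y 1 * y 2, y 1 * y 2 * y 3] : Fin 4 → ℝ)) ''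
          {x : Fin 4 → ℝ | ∀ i, x i ∈ Set.Ioo (0:ℝ) 1} := by rw [hTd, m4p_image13]
    have hNi' : EqOn N.integrand
        (fun x => g ![x 0, x 1, x 1 * x 2, x 1 * x 2 * x 3] * (x 1 ^ 2 * x 2))
        {x : Fin 4 → ℝ | ∀ i, x i ∈ Set.Ioo (0:ℝ) 1} := fun x hx => hNi (by rw [hNd]; exact hx)
    exact (m4p_transport13 g).2 N T hNd hNi' hTd' hTg
  · -- (P13) existence of the pull-back: conjunct 1 of the transport along `C₁₃`
    have hTd' : T.domain =
        (fun y : Fin 4 → ℝ => (![y 0, y 1, y 1 * y 2, y 1 * y 2 * y 3] : Fin 4 → ℝ)) ''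
          {x : Fin 4 → ℝ | ∀ i, x i ∈ Set.Ioo (0:ℝ) 1} := by rw [hTd, m4p_image13]
    exact (m4p_transport13 g).1 T hTd' hTg
  · -- (P22) the move: conjunct 2 of the transport along `C₂₂`
    have hTd' : T.domain =
        (fun y : Fin 4 → ℝ => (![y 0, y 0 * y 1, y 2, y 2 * y 3] : Fin 4 → ℝ)) ''
          {x : Fin 4 → ℝ | ∀ i, x i ∈ Set.Ioo (0:ℝ) 1} := by rw [hTd, m4p_image22]
    have hNi' : EqOn N.integrand (fun x => g ![x 0, x 0 * x 1, x 2, x 2 * x 3] * (x 0 * x 2))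
        {x : Fin 4 → ℝ | ∀ i, x i ∈ Set.Ioo (0:ℝ) 1} := fun x hx => hNi (by rw [hNd]; exact hx)
    exact (m4p_transport22 g).2 N T hNd hNi' hTd' hTg
  · -- (P22) existence of the pull-back: conjunct 1 of the transport along `C₂₂`
    have hTd' : T.domain =
        (fun y : Fin 4 → ℝ => (![y 0, y 0 * y 1, y 2, y 2 * y 3] : Fin 4 → ℝ)) ''
          {x : Fin 4 → ℝ | ∀ i, x i ∈ Set.Ioo (0:ℝ) 1} := by rw [hTd, m4p_image22]
    exact (m4p_transport22 g).1 T hTd' hTg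

end Summit.KontsevichZagierPeriods.HurwitzMicroSectors.NormalFormPrinciple.PiBox.M3
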